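import Mathlib.CategoryTheory.Comma.Arrow
import Literature.AlgebraicGeometry.Frobenioids.NumberFieldLocalizationCategories
import Literature.AlgebraicGeometry.Frobenioids.NumberFieldLocalizations
import Literature.AlgebraicGeometry.Frobenioids.BCatOrbits
import HarnessLib

/-!
# Frobenioids II, Example 1.4 / Proposition 1.5 (i): `P₀` is reconstructed from `E₀` by inverting the
# `P₀`-isomorphisms — the base case of the reconstruction bijection for the concrete `E₀ → P₀`

Mochizuki, *The geometry of Frobenioids II: poly-Frobenioids*, Kyushu J. Math. **62** (2008)
401–460, §1, Example 1.4 (ii) p. 13 and Proposition 1.5 (i) p. 13 with its proof p. 14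
[cite: MochizukiFrdII2008, Prop. 1.5 (i) pp.13-14]: "The bijection of assertion (i) follows
immediately from the definitions and the easily verified observation that such a bijection exists
when `P → P₀` is the identity functor on `P₀`."

The generic Proposition 1.5 files (`NumberFieldLocalizations*.lean`, abc-iut-L1-t8) take this
observation as the hypothesis structure `NFLoc.HomReconstruction π` on an abstract functor
`π : E₀ ⥤ P₀`. This PROOF-ONLY file discharges it for the CONCRETE functor of Example 1.4,
`NFLocCat.toP₀ G D : E₀ → P₀` (`E₀` = triples `(P, Q, ι : P ↪ Q|_D)`, `P₀ = B(D)⁰`, `Q₀ = B(G)⁰`;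
`NumberFieldLocalizationCategories.lean`), for any topological group `G` and subgroup `D`
(`homReconstruction_toP₀`):

* surjectivity: an arrow `g : P₁ → P₂` of `P₀` between the projections of `(P₁, Q₁, ι₁)`,
  `(P₂, Q₂, ι₂)` is presented by the object `Z = (D/(U ∩ D), G/U, dU∩D ↦ dU)`,
  `U := Stab(ι₁ p) ∩ Stab(ι₂ g(p))`, whose `P`-component maps isomorphically onto `P₁`;
* injectivity: two presentations of `g` are refined by the analogous object for
  `U := Stab(ι_Z z) ∩ Stab(ι_{Z'} z')`, `z`, `z'` the points over a base point of `P₁`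
  (maps out of single orbits are determined by one value).

Everything reduces, through the toolkit `BCatOrbits.lean` (abc-iut-L1-d9: coset objects `G/U`,
single orbits), to finite `G`-sets; the test object is the one of d9's `NFLocCat.exists_testObj`
(re-derived here with its stabilisers recorded). Also: arrow-wise essential surjectivity implies
essential surjectivity (`essSurj_of_isArrowwiseEssSurj`), so that together with d9's
`toP₀ArrowwiseEssSurj_holds` (profinite `G`) all hypotheses of the generic Proposition 1.5 theorems
are available for Example 1.4. No new definitions; nothing here bears on [IUTchIII].
-/

namespace Literature.AlgebraicGeometry.Frobenioids

open CategoryTheory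
open scoped FintypeCatDiscrete

universe v₁ v₂ u₁ u₂ u

/-! ### Arrow-wise essential surjectivity implies essential surjectivity -/

/-- An arrow-wise essentially surjective functor (FrdII §0 p. 5) is essentially surjective: the
identity of `X` is abstractly equivalent to the image of some arrow, whose source then maps
isomorphically to `X`. [cite: MochizukiFrdII2008, §0 p.5] -/
theorem essSurj_of_isArrowwiseEssSurj {C : Type u₁} [Category.{v₁} C] {B : Type u₂} [Category.{v₂} B]
    (Φ : C ⥤ B) (h : IsArrowwiseEssSurj Φ) : Φ.EssSurj := by
  refine ⟨fun X => ?_⟩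
  obtain ⟨A, B, f, ⟨e⟩⟩ := h (𝟙 X)
  exact ⟨A, ⟨Arrow.leftFunc.mapIso e⟩⟩

namespace NFLocCat

variable {G : Type u} [Group G] [TopologicalSpace G] (D : Subgroup G)

/-! ### Points and structure arrows of the objects of `E₀` -/

/-- An object `(P, Q, ι)` of `E₀` has a point of `P`. [cite: MochizukiFrdII2008, Ex. 1.4 (i) p.12] -/
private theorem nonempty_left' (T : ECat G D) : Nonempty T.obj.left.obj.obj.V :=
  BCat.nonempty_of_isNonemptyObj _ T.obj.left.property.1

/-- The structure arrow `ι : P → Q|_D` is injective on points. [cite: MochizukiFrdII2008, Ex. 1.4 (i) p.12] -/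
private theorem hom_injective' [IsTopologicalGroup G] (T : ECat G D) : Function.Injective T.obj.hom.hom.hom := by
  haveI : Mono T.obj.hom := T.property
  exact BCat.injective_of_mono T.obj.hom

/-- A point `p` of `P` is fixed by `d ∈ D` iff `ι(p)` is (`ι` is injective and equivariant).
[cite: MochizukiFrdII2008, Ex. 1.4 (i) p.12] -/
private theorem smul_eq_iff [IsTopologicalGroup G] (T : ECat G D) (p : T.obj.left.obj.obj.V) (d : D) :
    d • p = p ↔
      (d : G) ∈ MulAction.stabilizer G (α := T.obj.right.obj.obj.V) (T.obj.hom.hom.hom p) := by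
  have e := BCat.hom_smul (X := T.obj.left.obj) (Y := (res G D).obj T.obj.right.obj) T.obj.hom d p
  rw [MulAction.mem_stabilizer_iff]
  constructor
  · intro h
    exact (e.symm.trans (congrArg _ h) : _)
  · intro h
    apply hom_injective' D T
    exact e.trans h

/-- Two morphisms of `E₀` with the same `P`-component are equal (the `Q`-components agree at the image
of a point of `P`, and `Q` is a single orbit). [cite: MochizukiFrdII2008, Ex. 1.4 (ii) p.13] -/
private theorem hom_eq_of_left_eq' [IsTopologicalGroup G] {T T' : ECat G D} {f f' : T ⟶ T'} (h : f.hom.left = f'.hom.left) :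
    f = f' := by
  obtain ⟨p⟩ := nonempty_left' D T
  apply ObjectProperty.hom_ext
  apply Comma.hom_ext _ _ h
  apply ObjectProperty.hom_ext
  apply BCat.hom_eq_of_apply_eq T.obj.right.property (T.obj.hom.hom.hom p)
  have w₁ := congrArg (fun k => k.hom.hom p) f.hom.w
  have w₂ := congrArg (fun k => k.hom.hom p) f'.hom.w
  dsimp only at w₁ w₂
  change T'.obj.hom.hom.hom (f.hom.left.hom.hom.hom p) = f.hom.right.hom.hom.hom (T.obj.hom.hom.hom p)
    at w₁
  change T'.obj.hom.hom.hom (f'.hom.left.hom.hom.hom p) = f'.hom.right.hom.hom.hom (T.obj.hom.hom.hom p)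
    at w₂
  rw [h] at w₁
  exact w₁.symm.trans w₂

/-! ### The test object `(D/(U ∩ D), G/U)` with its stabilisers -/

/-- For points `q ∈ Q`, `q' ∈ Q'` of objects of `B(G)` and `U := Stab(q) ∩ Stab(q')`, the object
`T₄ = (D/(U ∩ D), G/U, dU∩D ↦ dU)` of `E₀` with base points `p₄ ↦ q₄` of stabilisers `U ∩ D`, `U`:
both components single orbits, with the mapping properties of coset objects (the test object of
abc-iut-L1-d9's `exists_testObj`, with its stabilisers recorded). [cite: MochizukiFrdII2008, Ex. 1.4 (ii) p.13] -/
private theorem exists_testObj₂ [IsTopologicalGroup G] (Q Q' : BCat G) (q : Q.obj.V) (q' : Q'.obj.V) :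
    ∃ (T₄ : ECat G D) (p₄ : T₄.obj.left.obj.obj.V) (q₄ : T₄.obj.right.obj.obj.V),
      T₄.obj.hom.hom.hom p₄ = q₄ ∧
      (∀ p : T₄.obj.left.obj.obj.V, ∃ d : D, d • p₄ = p) ∧
      (∀ z : T₄.obj.right.obj.obj.V, ∃ g : G, g • q₄ = z) ∧
      MulAction.stabilizer D p₄ =
        (MulAction.stabilizer G q ⊓ MulAction.stabilizer G q').subgroupOf D ∧
      (∀ (Y : BCat G) (y : Y.obj.V),
          MulAction.stabilizer G q ⊓ MulAction.stabilizer G q' ≤ MulAction.stabilizer G y →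
          ∃ b : T₄.obj.right.obj ⟶ Y, b.hom.hom q₄ = y) ∧
      (∀ (X : BCat D) (x : X.obj.V),
          (∀ d : D, (d : G) ∈ MulAction.stabilizer G q ⊓ MulAction.stabilizer G q' → d • x = x) →
          ∃ a : T₄.obj.left.obj ⟶ X, a.hom.hom p₄ = x) := by
  haveI := BCat.finiteIndex_stabilizer Q q
  haveI := BCat.finiteIndex_stabilizer Q' q'
  have hUo : IsOpen ((MulAction.stabilizer G q ⊓ MulAction.stabilizer G q' : Subgroup G) : Set G) :=
    (BCat.isOpen_stabilizer Q q).inter (BCat.isOpen_stabilizer Q' q')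
  obtain ⟨Q₄, q₄, hq₄, htrQ, hmapQ⟩ :=
    BCat.exists_coset_obj (MulAction.stabilizer G q ⊓ MulAction.stabilizer G q') hUo
  have hUDo : IsOpen (((MulAction.stabilizer G q ⊓ MulAction.stabilizer G q').subgroupOf D :
      Subgroup D) : Set D) := hUo.preimage continuous_subtype_val
  obtain ⟨P₄, p₄, hp₄, htrP, hmapP⟩ := BCat.exists_coset_obj (G := D)
    ((MulAction.stabilizer G q ⊓ MulAction.stabilizer G q').subgroupOf D) hUDo
  -- `ι₄ : P₄ → Q₄|_D`, `p₄ ↦ q₄`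
  obtain ⟨ι₄, hι₄⟩ := hmapP ((res G D).obj Q₄) q₄ fun d hd => by
    rw [Subgroup.mem_subgroupOf, ← hq₄] at hd
    exact MulAction.mem_stabilizer_iff.mpr (MulAction.mem_stabilizer_iff.mp hd)
  have hι₄m : Mono ι₄ := BCat.mono_of_injective ι₄ (BCat.injective_of_stabilizer_le ι₄ p₄ htrP
    fun d hd => by
      rw [hp₄, Subgroup.mem_subgroupOf, ← hq₄]
      rw [hι₄] at hd
      exact MulAction.mem_stabilizer_iff.mpr (MulAction.mem_stabilizer_iff.mp hd))
  let T₄ : ECat G D :=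
    ⟨⟨⟨P₄, BCat.isConnectedObj_of_transitive P₄ p₄ htrP⟩,
      ⟨Q₄, BCat.isConnectedObj_of_transitive Q₄ q₄ htrQ⟩, ι₄⟩, hι₄m⟩
  refine ⟨T₄, p₄, q₄, hι₄, htrP, htrQ, hp₄, fun Y y hy => hmapQ Y y hy, ?_⟩
  intro X x hx
  exact hmapP X x fun d hd => MulAction.mem_stabilizer_iff.mpr
    (hx d ((Subgroup.mem_subgroupOf).mp hd))

/-- A morphism `T₄ ⟶ T''` of `E₀` from components that are compatible at the base point of the single
orbit `P₄`. [cite: MochizukiFrdII2008, Ex. 1.4 (ii) p.13] -/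
private theorem exists_hom_of_apply {T₄ T'' : ECat G D} (p₄ : T₄.obj.left.obj.obj.V)
    (q₄ : T₄.obj.right.obj.obj.V) (hq : T₄.obj.hom.hom.hom p₄ = q₄)
    (htrP : ∀ p : T₄.obj.left.obj.obj.V, ∃ d : D, d • p₄ = p)
    (a : T₄.obj.left.obj ⟶ T''.obj.left.obj) (b : T₄.obj.right.obj ⟶ T''.obj.right.obj)
    (hab : T''.obj.hom.hom.hom (a.hom.hom p₄) = b.hom.hom q₄) :
    ∃ u : T₄ ⟶ T'', u.hom.left = ObjectProperty.homMk a ∧ u.hom.right = ObjectProperty.homMk b :=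
  ⟨ObjectProperty.homMk
    { left := ObjectProperty.homMk a
      right := ObjectProperty.homMk b
      w := BCat.hom_eq_of_apply_eq_of_transitive p₄ htrP (by
        change T''.obj.hom.hom.hom (a.hom.hom p₄) = b.hom.hom (T₄.obj.hom.hom.hom p₄)
        rw [hq]
        exact hab) }, rfl, rfl⟩

/-! ### Proposition 1.5 (i) for the identity functor of `P₀`: surjectivity -/

/-- Every arrow `g : P₁ → P₂` of `P₀` between projections of objects `(P₁, Q₁, ι₁)`, `(P₂, Q₂, ι₂)` of
`E₀` is presented as `(π s)⁻¹ ≫ π f` for a `P₀`-isomorphism `s : Z → (P₁, Q₁, ι₁)` and an arrow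
`f : Z → (P₂, Q₂, ι₂)` of `E₀`, `Z = (D/(U ∩ D), G/U)` with `U = Stab(ι₁ p) ∩ Stab(ι₂ g(p))`.
[cite: MochizukiFrdII2008, Prop. 1.5 (i) p.13] -/
theorem homReconstruction_toP₀_surj [IsTopologicalGroup G] (X Y : ECat G D) (g : (toP₀ G D).obj X ⟶ (toP₀ G D).obj Y) :
    ∃ (Z : ECat G D) (s : Z ⟶ X) (f : Z ⟶ Y),
      NFLoc.IsProjIso (toP₀ G D) s ∧ (toP₀ G D).map s ≫ g = (toP₀ G D).map f := by
  change X.obj.left ⟶ Y.obj.left at g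
  obtain ⟨p⟩ := nonempty_left' D X
  obtain ⟨T₄, p₄, q₄, hι, htrP, htrQ, hp₄, hmapQ, hmapP⟩ := exists_testObj₂ D X.obj.right.obj
    Y.obj.right.obj (X.obj.hom.hom.hom p) (Y.obj.hom.hom.hom (g.hom.hom.hom p))
  -- `d ∈ Stab(ι₁ p)` fixes `p`; `d ∈ Stab(ι₂ g(p))` fixes `g(p)`
  obtain ⟨a₁, ha₁⟩ := hmapP X.obj.left.obj p fun d hd =>
    (smul_eq_iff D X p d).mpr (Subgroup.mem_inf.mp hd).1
  obtain ⟨b₁, hb₁⟩ := hmapQ X.obj.right.obj (X.obj.hom.hom.hom p) inf_le_left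
  obtain ⟨a₂, ha₂⟩ := hmapP Y.obj.left.obj (g.hom.hom.hom p) fun d hd =>
    (smul_eq_iff D Y _ d).mpr (Subgroup.mem_inf.mp hd).2
  obtain ⟨b₂, hb₂⟩ := hmapQ Y.obj.right.obj (Y.obj.hom.hom.hom (g.hom.hom.hom p)) inf_le_right
  obtain ⟨s, hsl, hsr⟩ := exists_hom_of_apply D p₄ q₄ hι htrP a₁ b₁ (by rw [ha₁, hb₁])
  obtain ⟨f, hfl, hfr⟩ := exists_hom_of_apply D p₄ q₄ hι htrP a₂ b₂ (by rw [ha₂, hb₂])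
  refine ⟨T₄, s, f, ?_, ?_⟩
  · -- `s` is a `P₀`-isomorphism: `a₁ : D/(U ∩ D) → P₁` is bijective
    have hinj : Function.Injective a₁.hom.hom := by
      refine BCat.injective_of_stabilizer_le a₁ p₄ htrP fun d hd => ?_
      rw [ha₁, MulAction.mem_stabilizer_iff] at hd
      rw [hp₄, Subgroup.mem_subgroupOf, Subgroup.mem_inf]
      refine ⟨(smul_eq_iff D X p d).mp hd, (smul_eq_iff D Y _ d).mp ?_⟩
      exact ((BCat.hom_smul g.hom d p).symm.trans (congrArg _ hd) : _)
    have hsurj : Function.Surjective a₁.hom.hom :=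
      BCat.surjective_of_isConnectedObj a₁ p₄ X.obj.left.property
    haveI : IsIso a₁ := BCat.isIso_of_bijective a₁ ⟨hinj, hsurj⟩
    change IsIso s.hom.left
    rw [hsl]
    exact (ObjectProperty.isIso_hom_iff _).mp (inferInstanceAs (IsIso a₁))
  · change s.hom.left ≫ g = f.hom.left
    rw [hsl, hfl]
    apply ObjectProperty.hom_ext
    apply BCat.hom_eq_of_apply_eq_of_transitive p₄ htrP
    change g.hom.hom.hom (a₁.hom.hom p₄) = a₂.hom.hom p₄
    rw [ha₁, ha₂]

/-! ### Proposition 1.5 (i) for the identity functor of `P₀`: injectivity -/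

/-- Two presentations `(Z, s, f)`, `(Z', s', f')` of the same arrow of `P₀` admit a common refinement by
`P₀`-isomorphisms `W → Z`, `W → Z'`, `W = (D/(U ∩ D), G/U)` with `U = Stab(ι_Z z) ∩ Stab(ι_{Z'} z')`
for the points `z`, `z'` over a base point of `P₁`. [cite: MochizukiFrdII2008, Prop. 1.5 (i) p.13] -/
theorem homReconstruction_toP₀_inj [IsTopologicalGroup G] {X Y Z Z' : ECat G D} (s : Z ⟶ X) (f : Z ⟶ Y) (s' : Z' ⟶ X)
    (f' : Z' ⟶ Y) (g : (toP₀ G D).obj X ⟶ (toP₀ G D).obj Y) (hs : NFLoc.IsProjIso (toP₀ G D) s)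
    (hs' : NFLoc.IsProjIso (toP₀ G D) s') (hf : (toP₀ G D).map s ≫ g = (toP₀ G D).map f)
    (hf' : (toP₀ G D).map s' ≫ g = (toP₀ G D).map f') :
    ∃ (W : ECat G D) (t : W ⟶ Z) (t' : W ⟶ Z'), NFLoc.IsProjIso (toP₀ G D) t ∧
      NFLoc.IsProjIso (toP₀ G D) t' ∧ t ≫ s = t' ≫ s' ∧ t ≫ f = t' ≫ f' := by
  change X.obj.left ⟶ Y.obj.left at g
  obtain ⟨p⟩ := nonempty_left' D X
  haveI : IsIso s.hom.left := hs
  haveI : IsIso s'.hom.left := hs'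
  obtain ⟨z, hz⟩ := (BCat.bijective_of_isIso s.hom.left.hom).2 p
  obtain ⟨z', hz'⟩ := (BCat.bijective_of_isIso s'.hom.left.hom).2 p
  have hf₁ : f.hom.left.hom.hom.hom z = g.hom.hom.hom p := by
    have e := congrArg (fun k => InducedCategory.Hom.hom k) hf
    have e' := congrArg (fun k => k.hom.hom z) e
    change g.hom.hom.hom (s.hom.left.hom.hom.hom z) = f.hom.left.hom.hom.hom z at e'
    rw [hz] at e'
    exact e'.symm
  have hf₁' : f'.hom.left.hom.hom.hom z' = g.hom.hom.hom p := by
    have e := congrArg (fun k => InducedCategory.Hom.hom k) hf'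
    have e' := congrArg (fun k => k.hom.hom z') e
    change g.hom.hom.hom (s'.hom.left.hom.hom.hom z') = f'.hom.left.hom.hom.hom z' at e'
    rw [hz'] at e'
    exact e'.symm
  -- a point of `Z` fixed by `d` has its partner in `Z'` fixed by `d`, and conversely
  -- `Stab_D(z) = Stab_D(p) = Stab_D(z')` along the equivariant bijections `s`, `s'`
  have hsz : ∀ d : D, s.hom.left.hom.hom.hom (d • z) = d • p := fun d =>
    (BCat.hom_smul s.hom.left.hom d z).trans (congrArg _ hz)
  have hsz' : ∀ d : D, s'.hom.left.hom.hom.hom (d • z') = d • p := fun d =>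
    (BCat.hom_smul s'.hom.left.hom d z').trans (congrArg _ hz')
  have hzz' : ∀ d : D, d • z = z → d • z' = z' := fun d hd => by
    apply (BCat.bijective_of_isIso s'.hom.left.hom).1
    have e : d • p = p := ((hsz d).symm.trans (congrArg _ hd)).trans hz
    exact ((hsz' d).trans e).trans hz'.symm
  have hz'z : ∀ d : D, d • z' = z' → d • z = z := fun d hd => by
    apply (BCat.bijective_of_isIso s.hom.left.hom).1
    have e : d • p = p := ((hsz' d).symm.trans (congrArg _ hd)).trans hz'
    exact ((hsz d).trans e).trans hz.symm
  obtain ⟨T₄, p₄, q₄, hι, htrP, htrQ, hp₄, hmapQ, hmapP⟩ := exists_testObj₂ D Z.obj.right.obj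
    Z'.obj.right.obj (Z.obj.hom.hom.hom z) (Z'.obj.hom.hom.hom z')
  obtain ⟨a, ha⟩ := hmapP Z.obj.left.obj z fun d hd =>
    (smul_eq_iff D Z z d).mpr (Subgroup.mem_inf.mp hd).1
  obtain ⟨b, hb⟩ := hmapQ Z.obj.right.obj (Z.obj.hom.hom.hom z) inf_le_left
  obtain ⟨a', ha'⟩ := hmapP Z'.obj.left.obj z' fun d hd =>
    (smul_eq_iff D Z' z' d).mpr (Subgroup.mem_inf.mp hd).2
  obtain ⟨b', hb'⟩ := hmapQ Z'.obj.right.obj (Z'.obj.hom.hom.hom z') inf_le_right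
  obtain ⟨t, htl, htr⟩ := exists_hom_of_apply D p₄ q₄ hι htrP a b (by rw [ha, hb])
  obtain ⟨t', ht'l, ht'r⟩ := exists_hom_of_apply D p₄ q₄ hι htrP a' b' (by rw [ha', hb'])
  have hmem : ∀ d : D, d • z = z →
      d ∈ (MulAction.stabilizer G (α := Z.obj.right.obj.obj.V) (Z.obj.hom.hom.hom z) ⊓
        MulAction.stabilizer G (α := Z'.obj.right.obj.obj.V) (Z'.obj.hom.hom.hom z')).subgroupOf D :=
    fun d hd => by
      rw [Subgroup.mem_subgroupOf, Subgroup.mem_inf]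
      exact ⟨(smul_eq_iff D Z z d).mp hd, (smul_eq_iff D Z' z' d).mp (hzz' d hd)⟩
  have isoOf : ∀ {T'' : ECat G D} (c : T₄.obj.left.obj ⟶ T''.obj.left.obj) (w : T''.obj.left.obj.obj.V),
      c.hom.hom p₄ = w → (∀ d : D, d • w = w → d • z = z) → IsIso c := fun {T''} c w hc hw => by
    have hinj : Function.Injective c.hom.hom := by
      refine BCat.injective_of_stabilizer_le c p₄ htrP fun d hd => ?_
      rw [hc, MulAction.mem_stabilizer_iff] at hd
      rw [hp₄]
      exact hmem d (hw d hd)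
    have hsurj : Function.Surjective c.hom.hom :=
      BCat.surjective_of_isConnectedObj c p₄ T''.obj.left.property
    exact BCat.isIso_of_bijective c ⟨hinj, hsurj⟩
  refine ⟨T₄, t, t', ?_, ?_, ?_, ?_⟩
  · change IsIso t.hom.left
    rw [htl]
    haveI := isoOf a z ha fun d hd => hd
    exact (ObjectProperty.isIso_hom_iff _).mp (inferInstanceAs (IsIso a))
  · change IsIso t'.hom.left
    rw [ht'l]
    haveI := isoOf a' z' ha' hz'z
    exact (ObjectProperty.isIso_hom_iff _).mp (inferInstanceAs (IsIso a'))
  · apply hom_eq_of_left_eq' D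
    change t.hom.left ≫ s.hom.left = t'.hom.left ≫ s'.hom.left
    rw [htl, ht'l]
    apply ObjectProperty.hom_ext
    apply BCat.hom_eq_of_apply_eq_of_transitive p₄ htrP
    change s.hom.left.hom.hom.hom (a.hom.hom p₄) = s'.hom.left.hom.hom.hom (a'.hom.hom p₄)
    rw [ha, ha', hz, hz']
  · apply hom_eq_of_left_eq' D
    change t.hom.left ≫ f.hom.left = t'.hom.left ≫ f'.hom.left
    rw [htl, ht'l]
    apply ObjectProperty.hom_ext
    apply BCat.hom_eq_of_apply_eq_of_transitive p₄ htrP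
    change f.hom.left.hom.hom.hom (a.hom.hom p₄) = f'.hom.left.hom.hom.hom (a'.hom.hom p₄)
    rw [ha, ha', hf₁, hf₁']

/-! ### Proposition 1.5 (i), base case: the reconstruction bijection for `E₀ → P₀` -/

variable (G) in
/-- **Proposition 1.5 (i)**, base case (FrdII pp. 13–14: "the easily verified observation that such a
bijection exists when `P → P₀` is the identity functor on `P₀`"): `P₀ = B(D)⁰` is reconstructed from
`E₀` by inverting the `P₀`-isomorphisms — the hypothesis structure `NFLoc.HomReconstruction` of the
generic Proposition 1.5 files holds for the concrete functor `E₀ → P₀` of Example 1.4, for every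
topological group `G` and subgroup `D`. [cite: MochizukiFrdII2008, Prop. 1.5 (i) p.13] -/
theorem homReconstruction_toP₀ [IsTopologicalGroup G] : NFLoc.HomReconstruction (toP₀ G D) :=
  ⟨fun X Y g => homReconstruction_toP₀_surj D X Y g,
    fun s f s' f' g hs hs' hf hf' => homReconstruction_toP₀_inj D s f s' f' g hs hs' hf hf'⟩

end NFLocCat

end Literature.AlgebraicGeometry.Frobenioids
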